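import Literature.MathematicalPhysics.QuantumFieldTheory.Balaban1983to89.T4ShellMeasure
import Mathlib.Analysis.Convex.Topology
import Mathlib.Analysis.InnerProductSpace.Basic

/-!
# N21 (NE7c) · CONVEXITY ⇒ radial non-collapse about the CONSTRAINED MINIMISER; the fixed-centre near-miss toy; the
# one located number from kernel decay across the collar (lens Cards 79, 80 + W²⁵ toy ∕ ROW P companion)

R134 seat pub-ymgap-dag-n21-d (g8), node N21 = NE7c (single-run shell-weight bound, NOT PRINTED in [Bałaban 1983–89],
NOT proved), lane K3⁷ `SpineGivenEndpointR13SepCoPH` (stmt-QuantumFields-20544, `--kind proof --supports … --as helper`).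
Part 29 of the comparison series.  THIS FILE = §A + §B + §D of the lens's `Sketch-nearmiss-g27.lean` (LENS-nearmiss v27.0, companion of
ROW P; first refusal dag-n21-d) (farm rc 0 · 0 warnings at the lens desk) VERBATIM — statements and proofs — re-homed in this namespace.  AUTHORSHIP OF THE
MATHEMATICS: planner seat `ym-lens-BalabanUVNodes-nearmiss` g27 (memo-only seat, cannot file); this seat only files.

WHAT (lens).  §A the FIXED-CENTRE NEAR-MISS (W²⁵): for a block coupled to its exterior the fixed-centre non-collapse of parts
18∕19 is FALSE on the shell (sectioned toy `A(x,y) = (x+βy)²∕2 + y²∕2` rises under `x ↦ x∕2` at `x = 1, βy = −1`),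
and TRUE about the exterior-pinned minimiser `m(y) = −βy` for every `l ∈ [0,1]` (A2 witness).  §B (Card 79)
CONVEXITY ⇒ NON-COLLAPSE ABOUT THE CONSTRAINED MINIMISER: `φ` convex on a convex `K`, `m ∈ K` minimising `φ` on `K`
⇒ `φ (m + l • (z − m)) ≤ φ z` — no `∇φ(m) = 0`, no smallness; open convex kept cuts ride along the segment.  §D (Card 80)
THE ONE LOCATED NUMBER: the core reading of the pinned minimiser from KERNEL DECAY across the collar,
`|Σ_y R(x,y) z_y| ≤ B·C_δ·e^{−δw∕2}·Θ` (`core_reading_le_of_kernelDecay`), and `κ₀ ≥ ½` once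
`e^{−δw∕2} ≤ θ(1−ρ)∕(2BCΘ)` (`kappa_ge_half`) — `B, δ` = propagator decay ([CMP 99 (1985)] ∕ [III]), `w` = collar width, `Θ` =
exterior thresholds: LOCATED (lit-balaban desk ROW Q), not asserted.

HONEST FRAMING.  [textbook] measure theory ∕ convexity over the tree's typed (M1) frame (cited by name); every located input stays a
HYPOTHESIS; 0 def, 0 sorry; nothing of Bałaban's asserted; NE7c NOT PRINTED ∕ NOT proved; N21 NOT discharged; counts
unmoved (typed 28∕28 · discharged 5∕27); count-neutral; one finite 𝕋⁴ at fixed ε — nothing about ℝ⁴ ∕ OS ∕ mass gap ∕ Clay.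
-/

open MeasureTheory Set Function Module
open scoped ENNReal
open Literature.MathematicalPhysics.QuantumFieldTheory.Balaban1983to89
open Literature.MathematicalPhysics.QuantumFieldTheory.Balaban1983to89.T4ShellMeasure (SlotAntiConcentration)

namespace Summit.QuantumFields.YangMills.Theorems.N21ConstrainedMinNonCollapse

/-! ## §A  The fixed-centre near-miss and its re-centred repair, on the sectioned toy -/

/-- **FIXED-CENTRE BLOCK DILATION RAISES A SECTIONED ACTION.**  `A(x,y) = (x+βy)²/2 + y²/2` (block variable `x`,
exterior variable `y`, cross term `βxy`): at `β = 1`, `x = 1`, `y = −1`, `l = 1/2 ∈ [1/2, 1]` the action RISES under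
the block dilation `x ↦ l x` with the exterior frozen (`1/2 < 5/8`).  [textbook] -/
theorem fixedCentre_blockDilation_raises_action :
    ∃ β x y l : ℝ, l ∈ Icc (1 / 2 : ℝ) 1 ∧ 0 < x ∧
      (x + β * y) ^ 2 / 2 + y ^ 2 / 2 < (l * x + β * y) ^ 2 / 2 + y ^ 2 / 2 := by
  refine ⟨1, 1, -1, 1 / 2, ⟨le_rfl, by norm_num⟩, one_pos, ?_⟩
  norm_num

/-- … so part 18's block-radial non-collapse `g x ≤ g (D_l x)` (and part 19's `A (l • z) ≤ A z`) FAILS for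
`g = e^{−A}` at that shell point: the density DROPS under inward block dilation about the fixed centre. [textbook] -/
theorem fixedCentre_nonCollapse_fails :
    ∃ β x y l : ℝ, l ∈ Icc (1 / 2 : ℝ) 1 ∧ 0 < x ∧
      Real.exp (-((l * x + β * y) ^ 2 / 2 + y ^ 2 / 2)) < Real.exp (-((x + β * y) ^ 2 / 2 + y ^ 2 / 2)) := by
  obtain ⟨β, x, y, l, hl, hx, h⟩ := fixedCentre_blockDilation_raises_action
  exact ⟨β, x, y, l, hl, hx, Real.exp_lt_exp.2 (by linarith)⟩

/-- **RE-CENTRED AT THE PINNED MINIMISER THE SAME ACTION IS RADIALLY MONOTONE.**  About `m(y) = −βy` (the minimiser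
of `x ↦ A(x,y)` with the exterior `y` frozen), `A(m(y) + l·(x − m(y)), y) ≤ A(x, y)` for EVERY `l ∈ [0,1]`, every
`x, y, β` — no smallness, no window. [textbook] -/
theorem recentred_blockDilation_lowers_action (β x y l : ℝ) (hl0 : 0 ≤ l) (hl1 : l ≤ 1) :
    (-β * y + l * (x - -β * y) + β * y) ^ 2 / 2 + y ^ 2 / 2 ≤ (x + β * y) ^ 2 / 2 + y ^ 2 / 2 := by
  have h1 : -β * y + l * (x - -β * y) + β * y = l * (x + β * y) := by ring
  rw [h1, mul_pow]
  have h2 : l ^ 2 * (x + β * y) ^ 2 ≤ 1 * (x + β * y) ^ 2 :=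
    mul_le_mul_of_nonneg_right (by nlinarith) (sq_nonneg _)
  linarith

/-! ## §B  Convexity ⇒ radial non-collapse about a constrained minimiser; open convex cuts ride along -/

section Convex

variable {V : Type*} [AddCommGroup V] [Module ℝ V]

/-- **CONVEXITY ⇒ RADIAL MONOTONICITY ABOUT A CONSTRAINED MINIMISER.**  `φ` convex on a convex set `K` (the block
potential `A − log J − log(gauge-fixing density)` in the block variables, restricted to the kept convex cuts), `m ∈ K`
a minimiser of `φ` over `K`, `z ∈ K`, `l ∈ [0,1]`: `φ (m + l • (z − m)) ≤ φ z`.  Proof: `m + l(z−m) = (1−l)m + lz` and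
`φ((1−l)m + lz) ≤ (1−l)φ m + lφ z ≤ φ z`.  No stationarity of `m`, no smallness. [textbook] -/
theorem radialMono_about_constrainedMin {K : Set V} {φ : V → ℝ} (hφ : ConvexOn ℝ K φ) {m : V} (hm : m ∈ K)
    (hmin : ∀ w ∈ K, φ m ≤ φ w) {z : V} (hz : z ∈ K) {l : ℝ} (hl0 : 0 ≤ l) (hl1 : l ≤ 1) :
    φ (m + l • (z - m)) ≤ φ z := by
  have heq : m + l • (z - m) = (1 - l) • m + l • z := by
    rw [smul_sub, sub_smul, one_smul]
    abel
  have hconv := hφ.2 hm hz (show (0 : ℝ) ≤ 1 - l by linarith) hl0 (by ring)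
  rw [heq]
  refine hconv.trans ?_
  have := hmin z hz
  simp only [smul_eq_mul]
  nlinarith

/-- the density form: `e^{−φ}` does NOT COLLAPSE under the re-centred dilation — part 18's `hmono` ∕ part 19's `hmono`
hypothesis IN CENTRED COORDINATES. [textbook] -/
theorem nonCollapse_about_constrainedMin {K : Set V} {φ : V → ℝ} (hφ : ConvexOn ℝ K φ) {m : V} (hm : m ∈ K)
    (hmin : ∀ w ∈ K, φ m ≤ φ w) {z : V} (hz : z ∈ K) {l : ℝ} (hl0 : 0 ≤ l) (hl1 : l ≤ 1) :
    Real.exp (-φ z) ≤ Real.exp (-φ (m + l • (z - m))) :=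
  Real.exp_le_exp.2 (neg_le_neg (radialMono_about_constrainedMin hφ hm hmin hz hl0 hl1))

/-- the re-centred dilate stays in the convex constraint set (Mathlib `Convex.add_smul_sub_mem`). [textbook] -/
theorem recentredDil_mem {K : Set V} (hK : Convex ℝ K) {m z : V} (hm : m ∈ K) (hz : z ∈ K) {l : ℝ}
    (hl0 : 0 ≤ l) (hl1 : l ≤ 1) : m + l • (z - m) ∈ K :=
  hK.add_smul_sub_mem hm hz ⟨hl0, hl1⟩

/-- a sum of convex pieces is convex: the log-concave Haar Jacobian and the Gaussian gauge-fixing density JOIN the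
convex action cost-free (Mathlib `ConvexOn.add`). [textbook] -/
theorem convexOn_potential_add {K : Set V} {A negLogJ : V → ℝ} (hA : ConvexOn ℝ K A)
    (hJ : ConvexOn ℝ K negLogJ) : ConvexOn ℝ K (A + negLogJ) :=
  hA.add hJ

end Convex

section OpenCut

variable {V : Type*} [AddCommGroup V] [Module ℝ V] [TopologicalSpace V] [IsTopologicalAddGroup V]
  [ContinuousConstSMul ℝ V]

/-- **OPEN CONVEX KEPT CUTS RIDE ALONG — NO EXIT, NO ODDS.**  `K` open convex (a finite intersection of open
sub-level cuts `{u < θ'}` of convex — e.g. affine-radial — letters reading the block's variables), `m ∈ closure K`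
(the constrained minimiser may sit on the boundary), `z ∈ K`, `l ∈ (0,1]`: `m + l • (z − m) ∈ K`. [textbook] -/
theorem keptCut_noExit {K : Set V} (hK : Convex ℝ K) (hKo : IsOpen K) {m z : V} (hm : m ∈ closure K)
    (hz : z ∈ K) {l : ℝ} (hl0 : 0 < l) (hl1 : l ≤ 1) : m + l • (z - m) ∈ K := by
  have hz' : z ∈ interior K := by rwa [hKo.interior_eq]
  have h := hK.add_smul_sub_mem_interior' hm hz' ⟨hl0, hl1⟩
  rwa [hKo.interior_eq] at h

end OpenCut

/-! ## §D  The one located number: the core reading of the pinned minimiser, from kernel decay across the collar -/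

section Decay

variable {Sx Sy : Type*} [Fintype Sy]

/-- **KERNEL DECAY ACROSS THE COLLAR ⇒ SMALL CORE READING.**  A linear response `z ↦ (Σ_y R(x,y) z_y)_x` (the block
minimiser's dependence on the exterior data: `−H_bb⁻¹ H_be`, a lattice Green's function of the current step) with
kernel decay `|R(x,y)| ≤ B e^{−δ d(x,y)}`, half-rate summability `Σ_y e^{−δ d(x,y)/2} ≤ C`, exterior data bounded by
its thresholds `|z_y| ≤ Θ`, and a CORE site `x` at distance `≥ w` from every exterior site: the core component is
`≤ B·C·e^{−δw/2}·Θ`.  With `w` = collar width this is the offset bound `c₀` of the re-centred core statistic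
(`κ = 1 − c₀/θ(1−ρ)` in part 19/20's transversality).  `B, δ, C, w, Θ` are LOCATED inputs. [textbook] -/
theorem core_reading_le_of_kernelDecay (R d : Sx → Sy → ℝ) {B δ w C Θ : ℝ} (hB : 0 ≤ B) (hδ : 0 ≤ δ)
    (hΘ : 0 ≤ Θ) (hR : ∀ x y, |R x y| ≤ B * Real.exp (-(δ * d x y)))
    (hC : ∀ x, ∑ y, Real.exp (-(δ / 2 * d x y)) ≤ C) (z : Sy → ℝ) (hz : ∀ y, |z y| ≤ Θ) {x : Sx}
    (hfar : ∀ y, w ≤ d x y) :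
    |∑ y, R x y * z y| ≤ B * C * Real.exp (-(δ / 2 * w)) * Θ := by
  calc |∑ y, R x y * z y| ≤ ∑ y, |R x y * z y| := Finset.abs_sum_le_sum_abs _ _
    _ ≤ ∑ y, B * Real.exp (-(δ * d x y)) * Θ := Finset.sum_le_sum fun y _ => by
        rw [abs_mul]
        exact mul_le_mul (hR x y) (hz y) (abs_nonneg _) (by positivity)
    _ ≤ ∑ y, B * (Real.exp (-(δ / 2 * w)) * Real.exp (-(δ / 2 * d x y))) * Θ :=
        Finset.sum_le_sum fun y _ => by
          refine mul_le_mul_of_nonneg_right (mul_le_mul_of_nonneg_left ?_ hB) hΘ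
          rw [← Real.exp_add]
          refine Real.exp_le_exp.2 ?_
          have := hfar y
          nlinarith
    _ = B * Real.exp (-(δ / 2 * w)) * Θ * ∑ y, Real.exp (-(δ / 2 * d x y)) := by
        rw [Finset.mul_sum]
        exact Finset.sum_congr rfl fun y _ => by ring
    _ ≤ B * Real.exp (-(δ / 2 * w)) * Θ * C := mul_le_mul_of_nonneg_left (hC x) (by positivity)
    _ = B * C * Real.exp (-(δ / 2 * w)) * Θ := by ring

/-- **THE TRANSVERSALITY CONSTANT OF THE RE-CENTRED CORE STATISTIC.**  If the offset is at most half the inner shell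
radius, `c₀ ≤ θ(1−ρ)/2`, then `κ = 1 − c₀/(θ(1−ρ)) ≥ 1/2`: part 19's constant at most DOUBLES. [textbook] -/
theorem kappa_ge_half {c₀ θ ρ : ℝ} (hθ : 0 < θ) (hρ : ρ < 1) (hc : c₀ ≤ θ * (1 - ρ) / 2) :
    1 / 2 ≤ 1 - c₀ / (θ * (1 - ρ)) := by
  have ha : 0 < θ * (1 - ρ) := mul_pos hθ (by linarith)
  have h1 : c₀ / (θ * (1 - ρ)) ≤ 1 / 2 := by
    rw [div_le_iff₀ ha]
    linarith
  linarith

end Decay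

end Summit.QuantumFields.YangMills.Theorems.N21ConstrainedMinNonCollapse
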